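/-
Copyright (c) 2026 the pub-hodgecm-mathlib formalisation cell (harness21).  Prover seat hodgecm-mathlib-LH4-p14 (g2), req620 Track A «(D-RAM) FOUR-FRAME» squad
(unit U3_Laws, MS ROAD A Stage A₂ «RE-KEY tv = 2 ON MULTIPLICITY»; brick (O2b)-MULT dealt by LH4-p11 (g2)'s RULING 2026-09-04T00:53:03Z (3) under the heir LEAD's
RULING (R-21); Stage B lead LH4-p10 (g2); dealer LH4-plan (g11)).  2026-09-04.
-/
import Summits.HodgeConjecture.HodgeConjecture.Theorems.F0P3cDyRamDiagonalOrbitFibreCountMult   -- (O2b)-MULT FILE M1 (this seat): the pieces; brings ★ PARTS 1–3, ★ (O2c) engine §2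
import Mathlib.Tactic.LinearCombination
import Mathlib.Tactic.FieldSimp
import HarnessLib

/-!
# Crux `H413`, line LH4 «(D-RAM) FOUR-FRAME» road — unit U3_Laws (iii), MS ROAD A Stage A₂, brick (O2b)-MULT FILE M2: THE HEAD —
# `(Σ_{M ∈ 𝒯·M₀} #{(e, a) : diag(ϖ^{a})·M is a type-tv vertex of diag(c^{e})}) · [𝒰 : S_F(M₀)] = 8 · [𝒯 : S̃(M₀)] · #reps`

Cell `hodgecm-mathlib` (D-0151), FLOOR 0, crux item H413 = `stmt-HodgeConjecture-24833`, route of record `HCCMUnconditional`; squad F0∕P3c∕LH4 (req618∕req620).  THEOREMS ONLY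
(no `def`, no instance, no notation, no `sorry`); lane `--supports stmt-HodgeConjecture-24833 --as helper` (count-neutral).

THE FIBRE COUNT WITH MULTIPLICITY, definition-free currency (see FILE M1's header for the UNIQ₂ story and the rulings).  `Δ_tv(M₀)` — the `σ`-fixed non-degenerate `D` with
`M₀` a type-`tv` vertex of `diag D` — is given as the disjoint union of the `S_F(M₀)`-cosets of a finite set `reps` (`hΔ`, `hfree`); then
`(Σᶠ_{M ∈ 𝒯·M₀} #fibre_tv(M)) · [𝒰 : S_F(M₀)] = 8 · [𝒯 : S̃(M₀)] · #reps` — ★ PART 3 is `reps = {D₁}`, its vanishing head is `reps = ∅`, and `#reps = polarisationCount σ ϖ tv M₀`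
(★ StrataDefs ED. 3) is the follow-up `…MultHeads`.  PROOF (LH4-p10 MEMO-stableLaw-finite v1 §2 (3), re-keyed; `N(S̃) ≤ S_F` is NOT available — `N(S̃)` permutes the cosets):
Step 1 — along `diag(u)·M₀` the fibre is `{(e, a_D) : D ∈ reps, c^{e}·N(u)·w_D⁻¹ ∈ S_F}` (`D = N(ϖu^{a_D})·w_D`, ★ PART 2), the pairs being distinct for distinct `D` (`hfree`),
and the condition reads `N(u)·S_F = w_D·(c^{e})⁻¹·S_F`; Step 2 — so `#fibre(diag(u)·M₀) = #{(e, D) : N(u)S_F = κ(e, D)}`; Steps 3–6 — double count of `Σ_{ω ∈ Ω} #fibre(ω.1)` over the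
finite set `Ω = {(diag(u)·M₀, N(u)·S_F) : u ∈ 𝒯}`: by lattices it is `(Σ_{𝒯·M₀} #fibre)·[S̃ : S̃ ∩ H]` (FILE M1 `ncard_normClasses_over_lattice_eq`), by classes it is
`#reps · [N𝒯·S_F : N𝒯] · [H : S̃ ∩ H]` (FILE M1 `ncard_lattices_over_class_eq`, `exists_inv_unitNormMap_mul_mem_iff`, ★ PART 1 `card_filter_mem_coset_eq_relIndex`);
Step 7 — FILE M1's index identities `[N𝒯·S_F : N𝒯]·[𝒰 : S_F] = 8·[𝒯 : H]`, `[S̃ : S̃∩H]·[𝒯 : S̃] = [H : S̃∩H]·[𝒯 : H]` and cancellation of the finite non-zero `[S̃ : S̃∩H]·[𝒯 : H]`.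
HONEST LABEL.  Count-neutral (`--supports`); nothing printed is asserted; (MS) stays a PROVER TARGET; `HC_CM` is proved only modulo the 7 printed citations (2 remaining named inputs:
hLiu418 = `stmt-HodgeConjecture-24832`, h413 = `stmt-HodgeConjecture-24833`) until rung 0 closes.

## References
* [Kottwitz1986BaseChangeUnits] R. E. Kottwitz, *Base change for unit elements of Hecke algebras*, Compositio Math. 60 (1986), §1 pp. 240–241.
* [Rogawski1990] J. D. Rogawski, *Automorphic Representations of Unitary Groups in Three Variables*, Ann. of Math. Stud. 123 (1990), §4.9 Prop. 4.9.1 (a) p. 55.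
* [Serre1979] J.-P. Serre, *Local Fields*, GTM 67 (1979), Ch. V §3.
-/

set_option autoImplicit false

noncomputable section

namespace Summit.HodgeConjecture.HodgeConjecture.Cruxes.H413.F0P3cDyRamDiagonalOrbitFibreCountMultHead

open Matrix
open Literature.NumberTheory.Automorphic Literature.NumberTheory.Automorphic.HermitianLattice
open Literature.NumberTheory.Automorphic.UnitaryLatticeTree
open Summit.HodgeConjecture.HodgeConjecture.Cruxes.H413.F0P3cDyRamDiagonalTorusDefs
open Summit.HodgeConjecture.HodgeConjecture.Cruxes.H413.F0P3cDyRamDiagonalOrbitFibreTransport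
open Summit.HodgeConjecture.HodgeConjecture.Cruxes.H413.F0P3cDyRamTorusRepresentativesCount
open Summit.HodgeConjecture.HodgeConjecture.Cruxes.H413.F0P3cDyRamDiagonalPairReindex
open Summit.HodgeConjecture.HodgeConjecture.Cruxes.H413.F0P3cDyRamDiagonalOrbitFibreCount
open Summit.HodgeConjecture.HodgeConjecture.Cruxes.H413.F0P3cDyRamDiagonalOrbitAveraging (relIndex_fixedUnitStabilizer_ne_zero_of_finite)
open Summit.HodgeConjecture.HodgeConjecture.Cruxes.H413.F0P3cDyRamDiagonalOrbitFibreCountMult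
open scoped Valued WithZero Matrix MatrixGroups

variable {K : Type*} [Field K] [Valued K ℤᵐ⁰]

/-! ## HEAD — the fibre count with multiplicity -/

open Classical in
/-- **(O2b)-MULT · THE FIBRE COUNT ALONG A UNIT-TORUS ORBIT WITH MULTIPLICITY.**  `σ` an isometric involution, `|ϖ| = exp(−1)` with unit avatar `ϖu`, `c` a `σ`-fixed NON-NORM
unit with the (NI2) dichotomy, ANY `𝒪`-submodule `M₀` with FINITE unit-torus orbit, any type `tv`, and a finite set `reps` of `σ`-fixed non-degenerate vectors such that the
type-`tv` polarisations of `M₀` are EXACTLY the `S_F(M₀)`-translates of the members of `reps` (`hΔ`) and distinct members lie in distinct cosets (`hfree`).  Then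
`(Σᶠ_{M ∈ 𝒯·M₀} #{(e, a) : diag(ϖu^{a})·M is a type-tv vertex of diag(d_e)}) · [𝒰 : S_F(M₀)] = 8 · [𝒯 : S̃(M₀)] · #reps` (`d_e i = c` if `e i` else `1`).  No one-coset
hypothesis; `#reps = #(Δ_tv(M₀)∕S_F(M₀))` is the multiplicity `n_tv(M₀)` of the re-keyed Stage A₂ (★ `polarisationCount`). [cite: Kottwitz1986BaseChangeUnits, §1 pp. 240–241]
[cite: Rogawski1990, §4.9 Prop. 4.9.1 (a) p. 55] -/
theorem finsum_ncard_fibre_mul_relIndex_eq_mul_card {σ : K →+* K} (hσ : ∀ x, σ (σ x) = x) (hvσ : ∀ a, Valued.v (σ a) = Valued.v a)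
    {ϖ : K} (hϖ : Valued.v ϖ = WithZero.exp (-1 : ℤ)) (ϖu : Kˣ) (hϖu : (ϖu : K) = ϖ)
    {c : K} (hσc : σ c = c) (hcv : Valued.v c = 1) (hc : ¬ ∃ z : K, z * σ z = c)
    (hdich : ∀ x : K, σ x = x → x ≠ 0 → (∃ z : K, z * σ z = x) ∨ ∃ z : K, z * σ z = c * x)
    {M₀ : Submodule 𝒪[K] (Fin 3 → K)}
    (hfin : {M : Submodule 𝒪[K] (Fin 3 → K) | ∃ u ∈ unitTorus K 3, M = mapGL (diagGLUnits u) M₀}.Finite) (tv : ℕ)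
    (reps : Finset (Fin 3 → K)) (hrepsfix : ∀ D ∈ reps, ∀ i, σ (D i) = D i ∧ D i ≠ 0)
    (hΔ : ∀ D : Fin 3 → K, (∀ i, σ (D i) = D i ∧ D i ≠ 0) →
      (IsVertexLattice σ ϖ (Matrix.diagonal D) tv M₀ ↔ ∃ D₁ ∈ reps, ∃ u ∈ fixedUnitStabilizer σ M₀, ∀ i, D i = D₁ i * (u i : Kˣ)))
    (hfree : ∀ D₁ ∈ reps, ∀ D₂ ∈ reps, ∀ u ∈ fixedUnitStabilizer σ M₀, (∀ i, D₂ i = D₁ i * (u i : Kˣ)) → D₁ = D₂) :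
    (∑ᶠ M ∈ {M : Submodule 𝒪[K] (Fin 3 → K) | ∃ u ∈ unitTorus K 3, M = mapGL (diagGLUnits u) M₀},
        ({p : (Fin 3 → Bool) × (Fin 3 → ℤ) |
          IsVertexLattice σ ϖ (Matrix.diagonal fun i => if p.1 i then c else (1 : K)) tv (mapGL (diagGLUnits fun i => ϖu ^ p.2 i) M)} : Set _).ncard)
      * (fixedUnitStabilizer σ M₀).relIndex (fixedUnitTorus σ 3)
      = 8 * (unitStabilizer M₀).relIndex (unitTorus K 3) * reps.card := by
  classical
  have hc0 : c ≠ 0 := fun h => by simp [h] at hcv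
  have upi : ∀ {x y : Fin 3 → Kˣ}, (∀ i, ((x i : Kˣ) : K) = y i) → x = y := fun h => funext fun i => Units.ext (h i)
  set cU : Kˣ := Units.mk0 c hc0 with hcUdef
  have hcU : (cU : K) = c := rfl
  set cvec : (Fin 3 → Bool) → (Fin 3 → Kˣ) := fun e i => if e i then cU else 1 with hcvec
  have hcvec_val : ∀ e i, ((cvec e i : Kˣ) : K) = if e i then c else 1 := by
    intro e i; by_cases h : e i <;> simp [hcvec, h, hcU]
  have hcvec_ne : ∀ (e : Fin 3 → Bool) i, (if e i then c else (1 : K)) ≠ 0 := by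
    intro e i; by_cases h : e i <;> simp [h, hc0]
  have hcvec_v : ∀ (e : Fin 3 → Bool) i, Valued.v (if e i then c else (1 : K)) = 1 := by
    intro e i; by_cases h : e i <;> simp [h, hcv]
  have hcvec_fix : ∀ (e : Fin 3 → Bool) i, σ (if e i then c else (1 : K)) = if e i then c else 1 := by
    intro e i; by_cases h : e i <;> simp [h, hσc]
  have hcvecU : ∀ e, cvec e ∈ fixedUnitTorus σ 3 := by
    intro e
    rw [mem_fixedUnitTorus_iff]
    exact ⟨fun i => by rw [hcvec_val]; exact hcvec_v e i, fun i => by rw [hcvec_val]; exact hcvec_fix e i⟩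
  have hNT : (unitTorus K 3).map (unitNormMap σ 3) ≤ fixedUnitTorus σ 3 := map_unitNormMap_unitTorus_le hσ hvσ
  choose! aOf wOf hwU hDw using fun (D : Fin 3 → K) (hD : D ∈ reps) =>
    exists_zpow_fixedUnit_decomposition hσ hvσ hϖ ϖu hϖu hσc hcv hdich D (hrepsfix D hD)
  -- Step 1: the fibre along `diag(u)·M₀`: `(e, b)` is in it iff for some representative `D`, `b = a_D` and `c^e·N(u)·w_D⁻¹ ∈ S_F`
  have step1 : ∀ u ∈ unitTorus K 3, ∀ (e : Fin 3 → Bool) (b : Fin 3 → ℤ),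
      IsVertexLattice σ ϖ (Matrix.diagonal fun i => if e i then c else (1 : K)) tv
          (mapGL (diagGLUnits fun i => ϖu ^ b i) (mapGL (diagGLUnits u) M₀)) ↔
        ∃ D ∈ reps, b = aOf D ∧ cvec e * unitNormMap σ 3 u * (wOf D)⁻¹ ∈ fixedUnitStabilizer σ M₀ := by
    intro u hu e b
    rw [← mapGL_mul, ← map_mul, isVertexLattice_diagonal_mapGL_diagGLUnits_iff]
    have hDfix : ∀ i, σ ((if e i then c else (1 : K)) * ((((fun j => ϖu ^ b j) * u) i : Kˣ) * σ (((fun j => ϖu ^ b j) * u) i : Kˣ)))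
        = (if e i then c else (1 : K)) * ((((fun j => ϖu ^ b j) * u) i : Kˣ) * σ (((fun j => ϖu ^ b j) * u) i : Kˣ)) ∧
        (if e i then c else (1 : K)) * ((((fun j => ϖu ^ b j) * u) i : Kˣ) * σ (((fun j => ϖu ^ b j) * u) i : Kˣ)) ≠ 0 := fun i =>
      ⟨by rw [map_mul, map_mul, hcvec_fix, hσ, mul_comm (σ _) (_ : K)],
        mul_ne_zero (hcvec_ne e i) (mul_ne_zero (Units.ne_zero _) ((map_ne_zero σ).2 (Units.ne_zero _)))⟩
    rw [hΔ _ hDfix]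
    refine exists_congr fun D => and_congr_right fun hD => ?_
    have hwU' := (mem_fixedUnitTorus_iff σ (wOf D)).1 (hwU D hD)
    have key : ∀ s : Fin 3 → Kˣ, (∀ i, (if e i then c else (1 : K)) * ((((fun j => ϖu ^ b j) * u) i : Kˣ) * σ (((fun j => ϖu ^ b j) * u) i : Kˣ))
          = D i * (s i : Kˣ)) ↔
        unitNormMap σ 3 (fun j => ϖu ^ b j) * (cvec e * unitNormMap σ 3 u) = unitNormMap σ 3 (fun j => ϖu ^ aOf D j) * (wOf D * s) := by
      intro s
      constructor
      · intro h
        refine upi fun i => ?_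
        have := h i
        rw [hDw D hD i, unitNormMap_apply, Pi.mul_apply, Units.val_mul, map_mul] at this
        simp only [Pi.mul_apply, Units.val_mul, unitNormMap_apply, hcvec_val]
        linear_combination this
      · intro h i
        have := congrArg (fun f : Fin 3 → Kˣ => ((f i : Kˣ) : K)) h
        simp only [Pi.mul_apply, Units.val_mul, unitNormMap_apply, hcvec_val] at this
        rw [hDw D hD i, unitNormMap_apply, Pi.mul_apply, Units.val_mul, map_mul]
        linear_combination this
    constructor
    · rintro ⟨s, hsSF, hs⟩
      rw [key] at hs
      have hsU := ((mem_fixedUnitStabilizer_iff σ M₀ s).1 hsSF).2.1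
      have hb : b = aOf D := by
        funext i
        have := congrArg (fun f : Fin 3 → Kˣ => Valued.v ((f i : Kˣ) : K)) hs
        simp only [Pi.mul_apply, Units.val_mul, map_mul] at this
        rw [hcvec_val, hcvec_v, v_unitNormMap_zpow hvσ hϖ ϖu hϖu, v_unitNormMap_of_mem_unitTorus hvσ hu,
          v_unitNormMap_zpow hvσ hϖ ϖu hϖu, hwU'.1 i, hsU i] at this
        simp only [mul_one, WithZero.exp_inj] at this
        omega
      subst hb
      refine ⟨rfl, ?_⟩
      have hs2 : cvec e * unitNormMap σ 3 u = wOf D * s := mul_left_cancel hs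
      rw [hs2, mul_inv_cancel_comm]
      exact hsSF
    · rintro ⟨rfl, hmem⟩
      refine ⟨cvec e * unitNormMap σ 3 u * (wOf D)⁻¹, hmem, ?_⟩
      rw [key, mul_inv_cancel_comm_assoc]
  set φ : (Fin 3 → Kˣ) →* (Fin 3 → Kˣ) ⧸ fixedUnitStabilizer σ M₀ :=
    (QuotientGroup.mk' (fixedUnitStabilizer σ M₀)).comp (unitNormMap σ 3) with hφ
  have hφeq : ∀ u y : Fin 3 → Kˣ, φ u = QuotientGroup.mk' (fixedUnitStabilizer σ M₀) y ↔
      (unitNormMap σ 3 u)⁻¹ * y ∈ fixedUnitStabilizer σ M₀ := by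
    intro u y
    rw [hφ, MonoidHom.comp_apply, QuotientGroup.mk'_apply, QuotientGroup.mk'_apply, QuotientGroup.eq]
  set κ : (Fin 3 → Bool) × (Fin 3 → K) → (Fin 3 → Kˣ) ⧸ fixedUnitStabilizer σ M₀ :=
    fun q => QuotientGroup.mk' (fixedUnitStabilizer σ M₀) (wOf q.2 * (cvec q.1)⁻¹) with hκ
  have hcond : ∀ (u : Fin 3 → Kˣ) (e : Fin 3 → Bool) (D : Fin 3 → K),
      cvec e * unitNormMap σ 3 u * (wOf D)⁻¹ ∈ fixedUnitStabilizer σ M₀ ↔ φ u = κ (e, D) := by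
    intro u e D
    simp only [hκ]
    rw [hφeq]
    have hid : (unitNormMap σ 3 u)⁻¹ * (wOf D * (cvec e)⁻¹) = (cvec e * unitNormMap σ 3 u * (wOf D)⁻¹)⁻¹ := by
      refine upi fun i => ?_
      simp only [Pi.mul_apply, Pi.inv_apply, Units.val_mul, Units.val_inv_eq_inv_val]
      field_simp
    rw [hid, inv_mem_iff]
  -- Step 2: the fibre over `diag(u)·M₀` in `(e, D)`-currency
  set Orb : Set (Submodule 𝒪[K] (Fin 3 → K)) := {M | ∃ u ∈ unitTorus K 3, M = mapGL (diagGLUnits u) M₀} with hOrb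
  set Fib : Submodule 𝒪[K] (Fin 3 → K) → Set ((Fin 3 → Bool) × (Fin 3 → ℤ)) := fun M =>
    {p | IsVertexLattice σ ϖ (Matrix.diagonal fun i => if p.1 i then c else (1 : K)) tv (mapGL (diagGLUnits fun i => ϖu ^ p.2 i) M)} with hFib
  have hFibF : ∀ u ∈ unitTorus K 3, Fib (mapGL (diagGLUnits u) M₀) =
      ↑(((Finset.univ ×ˢ reps).filter fun q : (Fin 3 → Bool) × (Fin 3 → K) => φ u = κ q).image fun q => (q.1, aOf q.2)) := by
    intro u hu
    ext p
    rw [Finset.coe_image, Set.mem_image]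
    constructor
    · intro hp
      obtain ⟨D, hD, hb, hmem⟩ := (step1 u hu p.1 p.2).1 hp
      refine ⟨(p.1, D), ?_, Prod.ext rfl hb.symm⟩
      rw [Finset.mem_coe, Finset.mem_filter]
      exact ⟨Finset.mem_product.2 ⟨Finset.mem_univ _, hD⟩, (hcond u p.1 D).1 hmem⟩
    · rintro ⟨q, hq, rfl⟩
      rw [Finset.mem_coe, Finset.mem_filter, Finset.mem_product] at hq
      exact (step1 u hu q.1 (aOf q.2)).2 ⟨q.2, hq.1.2, rfl, (hcond u q.1 q.2).2 hq.2⟩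
  have hinjOn : ∀ u ∈ unitTorus K 3, Set.InjOn (fun q : (Fin 3 → Bool) × (Fin 3 → K) => (q.1, aOf q.2))
      ↑((Finset.univ ×ˢ reps).filter fun q : (Fin 3 → Bool) × (Fin 3 → K) => φ u = κ q) := by
    intro u hu q₁ hq₁ q₂ hq₂ heq
    rw [Finset.mem_coe, Finset.mem_filter, Finset.mem_product] at hq₁ hq₂
    obtain ⟨he, hb⟩ := Prod.mk.inj heq
    have h1 := (hcond u q₁.1 q₁.2).2 hq₁.2
    have h2 := (hcond u q₂.1 q₂.2).2 hq₂.2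
    rw [he] at h1
    have hs : wOf q₁.2 * (wOf q₂.2)⁻¹ ∈ fixedUnitStabilizer σ M₀ := by
      have := (fixedUnitStabilizer σ M₀).mul_mem ((fixedUnitStabilizer σ M₀).inv_mem h1) h2
      have hid : (cvec q₂.1 * unitNormMap σ 3 u * (wOf q₁.2)⁻¹)⁻¹ * (cvec q₂.1 * unitNormMap σ 3 u * (wOf q₂.2)⁻¹)
          = wOf q₁.2 * (wOf q₂.2)⁻¹ := by
        refine upi fun i => ?_
        simp only [Pi.mul_apply, Pi.inv_apply, Units.val_mul, Units.val_inv_eq_inv_val]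
        field_simp
      rwa [hid] at this
    have hD12 : q₁.2 = q₂.2 := by
      refine hfree q₁.2 hq₁.1.2 q₂.2 hq₂.1.2 (wOf q₁.2 * (wOf q₂.2)⁻¹)⁻¹ ((fixedUnitStabilizer σ M₀).inv_mem hs) fun i => ?_
      rw [hDw q₂.2 hq₂.1.2 i, hDw q₁.2 hq₁.1.2 i, hb]
      simp only [Pi.mul_apply, Pi.inv_apply, Units.val_mul, Units.val_inv_eq_inv_val]
      field_simp
    exact Prod.ext he hD12
  have hFibcard : ∀ u ∈ unitTorus K 3, (Fib (mapGL (diagGLUnits u) M₀)).ncard =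
      ((Finset.univ ×ˢ reps).filter fun q : (Fin 3 → Bool) × (Fin 3 → K) => φ u = κ q).card := by
    intro u hu
    rw [hFibF u hu, Set.ncard_coe_finset, Finset.card_image_of_injOn (hinjOn u hu)]
  have hFibfin : ∀ M ∈ Orb, (Fib M).Finite := by
    rintro M ⟨u, hu, rfl⟩
    rw [hFibF u hu]
    exact Finset.finite_toSet _
  -- Step 3: the subgroup `X = N⁻¹S_F`, the eight classes, non-vanishing indices
  set X : Subgroup (Fin 3 → Kˣ) := (fixedUnitStabilizer σ M₀).comap (unitNormMap σ 3) with hX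
  have hkerφ : φ.ker = X := by rw [hφ, ← MonoidHom.comap_ker, QuotientGroup.ker_mk']
  have hrep : ∀ x ∈ fixedUnitTorus σ 3, ∃! e : Fin 3 → Bool, x * (cvec e)⁻¹ ∈ (unitTorus K 3).map (unitNormMap σ 3) :=
    fun x hx => existsUnique_signVector_mem_map_unitNormMap hvσ hσc hcv hc hdich cU hcU x hx
  have h8 : ((unitTorus K 3).map (unitNormMap σ 3)).relIndex (fixedUnitTorus σ 3) = 8 :=
    relIndex_map_unitNormMap_unitTorus_eq_eight hσ hvσ hσc hcv hc hdich
  have hSF0 : (fixedUnitStabilizer σ M₀).relIndex (fixedUnitTorus σ 3) ≠ 0 := relIndex_fixedUnitStabilizer_ne_zero_of_finite σ hfin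
  have hE := relIndex_map_sup_mul_relIndex_eq (unitTorus K 3) (fixedUnitTorus σ 3) (latticeStabilizer M₀) (unitNormMap σ 3) hNT
  rw [h8] at hE
  change ((unitTorus K 3).map (unitNormMap σ 3)).relIndex ((unitTorus K 3).map (unitNormMap σ 3) ⊔ latticeStabilizer M₀ ⊓ fixedUnitTorus σ 3) *
      (fixedUnitStabilizer σ M₀).relIndex (fixedUnitTorus σ 3) = 8 * (unitTorus K 3 ⊓ X).relIndex (unitTorus K 3) at hE
  rw [Subgroup.inf_relIndex_left] at hE
  set m : ℕ := ((unitTorus K 3).map (unitNormMap σ 3)).relIndex ((unitTorus K 3).map (unitNormMap σ 3) ⊔ latticeStabilizer M₀ ⊓ fixedUnitTorus σ 3) with hm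
  have hm0 : m ≠ 0 := fun h0 => by
    have := Subgroup.relIndex_eq_zero_of_le_right (H := (unitTorus K 3).map (unitNormMap σ 3))
      (sup_le hNT inf_le_right : (unitTorus K 3).map (unitNormMap σ 3) ⊔ latticeStabilizer M₀ ⊓ fixedUnitTorus σ 3 ≤ fixedUnitTorus σ 3) h0
    rw [h8] at this
    exact absurd this (by norm_num)
  have hXT0 : X.relIndex (unitTorus K 3) ≠ 0 := by
    intro h0
    rw [h0, mul_zero] at hE
    rcases mul_eq_zero.1 hE with h | h
    · exact hm0 h
    · exact hSF0 h
  have hST : unitStabilizer M₀ ≤ unitTorus K 3 := fun x hx => (Subgroup.mem_inf.1 hx).2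
  have hXS0 : X.relIndex (unitStabilizer M₀) ≠ 0 := fun h0 => hXT0 (Subgroup.relIndex_eq_zero_of_le_right hST h0)
  -- Step 4: `Ω`, its slices over lattices and over classes
  set Ω : Set (Submodule 𝒪[K] (Fin 3 → K) × ((Fin 3 → Kˣ) ⧸ fixedUnitStabilizer σ M₀)) :=
    {ω | ∃ u ∈ unitTorus K 3, ω = (mapGL (diagGLUnits u) M₀, φ u)} with hΩ
  set slice : Submodule 𝒪[K] (Fin 3 → K) → Set ((Fin 3 → Kˣ) ⧸ fixedUnitStabilizer σ M₀) := fun M => {θ | (M, θ) ∈ Ω} with hslice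
  have hΩOrb : ∀ (M : Submodule 𝒪[K] (Fin 3 → K)) (θ : (Fin 3 → Kˣ) ⧸ fixedUnitStabilizer σ M₀), (M, θ) ∈ Ω → M ∈ Orb := by
    rintro M θ ⟨u, hu, h⟩
    exact ⟨u, hu, (Prod.mk.inj h).1⟩
  have hslicecard : ∀ u ∈ unitTorus K 3, (slice (mapGL (diagGLUnits u) M₀)).ncard = X.relIndex (unitStabilizer M₀) := fun u hu =>
    ncard_normClasses_over_lattice_eq σ M₀ u hu
  have hslicefin : ∀ u ∈ unitTorus K 3, (slice (mapGL (diagGLUnits u) M₀)).Finite := fun u hu =>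
    Set.finite_of_ncard_ne_zero (by rw [hslicecard u hu]; exact hXS0)
  have hclass : ∀ y : Fin 3 → Kˣ, {ω ∈ Ω | ω.2 = QuotientGroup.mk' (fixedUnitStabilizer σ M₀) y}.ncard =
      if ∃ u₀ ∈ unitTorus K 3, (unitNormMap σ 3 u₀)⁻¹ * y ∈ fixedUnitStabilizer σ M₀
      then (latticeStabilizer M₀).relIndex (unitTorus K 3 ⊓ X) else 0 := fun y =>
    ncard_lattices_over_class_eq σ M₀ y
  -- Step 5: which classes `κ(e, D)` are occupied, and how many `e` per representative (★ PART 1)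
  have hgood_iff : ∀ (e : Fin 3 → Bool) (D : Fin 3 → K),
      (∃ u₀ ∈ unitTorus K 3, (unitNormMap σ 3 u₀)⁻¹ * (wOf D * (cvec e)⁻¹) ∈ fixedUnitStabilizer σ M₀) ↔
        (wOf D)⁻¹ * cvec e ∈ (unitTorus K 3).map (unitNormMap σ 3) ⊔ latticeStabilizer M₀ ⊓ fixedUnitTorus σ 3 := fun e D =>
    exists_inv_unitNormMap_mul_mem_iff σ M₀ (wOf D) (cvec e)
  have hgood_card : ∀ D ∈ reps, (Finset.univ.filter fun e : Fin 3 → Bool =>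
        ∃ u₀ ∈ unitTorus K 3, (unitNormMap σ 3 u₀)⁻¹ * (wOf D * (cvec e)⁻¹) ∈ fixedUnitStabilizer σ M₀).card = m := by
    intro D hD
    have hXU : (unitTorus K 3).map (unitNormMap σ 3) ⊔ latticeStabilizer M₀ ⊓ fixedUnitTorus σ 3 ≤ fixedUnitTorus σ 3 := sup_le hNT inf_le_right
    rw [hm, ← card_filter_mem_coset_eq_relIndex ((unitTorus K 3).map (unitNormMap σ 3)) _ (fixedUnitTorus σ 3) le_sup_left hXU cvec hcvecU hrep
      (wOf D) (hwU D hD)]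
    congr 1
    ext e
    simp only [Finset.mem_filter, Finset.mem_univ, true_and]
    exact hgood_iff e D
  have hinner : ∀ D ∈ reps, ∑ e : Fin 3 → Bool, {ω ∈ Ω | ω.2 = κ (e, D)}.ncard = m * (latticeStabilizer M₀).relIndex (unitTorus K 3 ⊓ X) := by
    intro D hD
    have hterm : ∀ e : Fin 3 → Bool, {ω ∈ Ω | ω.2 = κ (e, D)}.ncard =
        if ∃ u₀ ∈ unitTorus K 3, (unitNormMap σ 3 u₀)⁻¹ * (wOf D * (cvec e)⁻¹) ∈ fixedUnitStabilizer σ M₀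
        then (latticeStabilizer M₀).relIndex (unitTorus K 3 ⊓ X) else 0 := fun e => by
      simp only [hκ]
      exact hclass _
    rw [Finset.sum_congr rfl fun e _ => hterm e, Finset.sum_ite, Finset.sum_const_zero, add_zero, Finset.sum_const, smul_eq_mul,
      hgood_card D hD]
  -- Step 6: the double count of `Σ_{ω ∈ Ω} #fibre(ω.1)`
  have hΩsub : Ω ⊆ Orb ×ˢ (φ '' (unitTorus K 3 : Set (Fin 3 → Kˣ))) := by
    rintro ω ⟨u, hu, rfl⟩
    exact Set.mk_mem_prod ⟨u, hu, rfl⟩ ⟨u, hu, rfl⟩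
  have hφTcard : (φ '' (unitTorus K 3 : Set (Fin 3 → Kˣ))).ncard = X.relIndex (unitTorus K 3) := by
    rw [← hkerφ, Subgroup.relIndex_ker]
    exact (Nat.card_coe_set_eq _).symm
  have hΩfin : Ω.Finite := (hfin.prod (Set.finite_of_ncard_ne_zero (by rw [hφTcard]; exact hXT0))).subset hΩsub
  -- (a) over lattices: `Σ_Ω #fibre(ω.1) = (Σ_{Orb} #fibre) · [S̃ : S̃ ∩ H]`
  set Pset : Set (Submodule 𝒪[K] (Fin 3 → K) × ((Fin 3 → Bool) × (Fin 3 → ℤ))) := {mp | mp.1 ∈ Orb ∧ mp.2 ∈ Fib mp.1} with hPset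
  have hPsetfin : Pset.Finite := by
    refine (hfin.prod ((Finset.univ ×ˢ reps).image fun q : (Fin 3 → Bool) × (Fin 3 → K) => (q.1, aOf q.2)).finite_toSet).subset ?_
    rintro ⟨M, p⟩ ⟨hM, hp⟩
    refine Set.mk_mem_prod hM ?_
    obtain ⟨u, hu, rfl⟩ := hM
    have hp' : p ∈ Fib (mapGL (diagGLUnits u) M₀) := hp
    rw [hFibF u hu, Finset.mem_coe, Finset.mem_image] at hp'
    obtain ⟨q, hq, rfl⟩ := hp'
    rw [Finset.mem_coe, Finset.mem_image]
    exact ⟨q, (Finset.mem_filter.1 hq).1, rfl⟩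
  have hPsetcard : Pset.ncard = ∑ᶠ M ∈ Orb, (Fib M).ncard := ncard_setOf_mem_and_mem_eq_finsum_mem hfin Fib hFibfin
  have hA1 : {ωp : (Submodule 𝒪[K] (Fin 3 → K) × ((Fin 3 → Kˣ) ⧸ fixedUnitStabilizer σ M₀)) × ((Fin 3 → Bool) × (Fin 3 → ℤ)) |
      ωp.1 ∈ Ω ∧ ωp.2 ∈ Fib ωp.1.1}.ncard = ∑ᶠ ω ∈ Ω, (Fib ω.1).ncard :=
    ncard_setOf_mem_and_mem_eq_finsum_mem hΩfin (fun ω => Fib ω.1) (by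
      rintro ω ⟨u, hu, rfl⟩
      exact hFibfin _ ⟨u, hu, rfl⟩)
  have hA2 : {ωp : (Submodule 𝒪[K] (Fin 3 → K) × ((Fin 3 → Kˣ) ⧸ fixedUnitStabilizer σ M₀)) × ((Fin 3 → Bool) × (Fin 3 → ℤ)) |
      ωp.1 ∈ Ω ∧ ωp.2 ∈ Fib ωp.1.1}.ncard =
      {mθ : (Submodule 𝒪[K] (Fin 3 → K) × ((Fin 3 → Bool) × (Fin 3 → ℤ))) × ((Fin 3 → Kˣ) ⧸ fixedUnitStabilizer σ M₀) |
        mθ.1 ∈ Pset ∧ mθ.2 ∈ slice mθ.1.1}.ncard := by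
    have hinj : Function.Injective (fun ωp : (Submodule 𝒪[K] (Fin 3 → K) × ((Fin 3 → Kˣ) ⧸ fixedUnitStabilizer σ M₀)) ×
        ((Fin 3 → Bool) × (Fin 3 → ℤ)) => ((ωp.1.1, ωp.2), ωp.1.2)) := by
      rintro ⟨⟨M, θ⟩, p⟩ ⟨⟨M', θ'⟩, p'⟩ h
      simp only [Prod.mk.injEq] at h
      obtain ⟨⟨rfl, rfl⟩, rfl⟩ := h
      rfl
    rw [← Set.ncard_image_of_injective _ hinj]
    congr 1
    ext ⟨⟨M, p⟩, θ⟩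
    simp only [Set.mem_image, Set.mem_setOf_eq, Prod.mk.injEq, hPset]
    constructor
    · rintro ⟨⟨⟨M', θ'⟩, p'⟩, ⟨hω, hp⟩, ⟨rfl, rfl⟩, rfl⟩
      exact ⟨⟨hΩOrb _ _ hω, hp⟩, hω⟩
    · rintro ⟨⟨-, hp⟩, hθ⟩
      exact ⟨⟨⟨M, θ⟩, p⟩, ⟨hθ, hp⟩, ⟨rfl, rfl⟩, rfl⟩
  have hA3 : {mθ : (Submodule 𝒪[K] (Fin 3 → K) × ((Fin 3 → Bool) × (Fin 3 → ℤ))) × ((Fin 3 → Kˣ) ⧸ fixedUnitStabilizer σ M₀) |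
      mθ.1 ∈ Pset ∧ mθ.2 ∈ slice mθ.1.1}.ncard = ∑ᶠ mp ∈ Pset, (slice mp.1).ncard :=
    ncard_setOf_mem_and_mem_eq_finsum_mem hPsetfin (fun mp => slice mp.1) (by
      rintro ⟨M, p⟩ ⟨⟨u, hu, hM⟩, -⟩
      dsimp only at hM ⊢
      rw [hM]
      exact hslicefin u hu)
  have hA4 : ∑ᶠ mp ∈ Pset, (slice mp.1).ncard = Pset.ncard * X.relIndex (unitStabilizer M₀) := by
    rw [finsum_mem_congr rfl (fun mp hmp => by
      obtain ⟨⟨u, hu, hM⟩, -⟩ := hmp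
      rw [hM]
      exact hslicecard u hu : ∀ mp ∈ Pset, (slice mp.1).ncard = X.relIndex (unitStabilizer M₀)),
      finsum_mem_eq_finite_toFinset_sum _ hPsetfin, Finset.sum_const, smul_eq_mul, Set.ncard_eq_toFinset_card _ hPsetfin]
  -- (b) over classes: `Σ_Ω #fibre(ω.1) = Σ_Ω G(ω.2) = Σ_{(e, D)} #{ω ∈ Ω : ω.2 = κ(e, D)} = #reps · m · [H : S̃ ∩ H]`
  have hB1 : ∑ᶠ ω ∈ Ω, (Fib ω.1).ncard =
      ∑ᶠ ω ∈ Ω, ((Finset.univ ×ˢ reps).filter fun q : (Fin 3 → Bool) × (Fin 3 → K) => ω.2 = κ q).card :=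
    finsum_mem_congr rfl (by
      rintro ω ⟨u, hu, rfl⟩
      exact hFibcard u hu)
  have hB2' : {ωq : (Submodule 𝒪[K] (Fin 3 → K) × ((Fin 3 → Kˣ) ⧸ fixedUnitStabilizer σ M₀)) × ((Fin 3 → Bool) × (Fin 3 → K)) |
        ωq.1 ∈ Ω ∧ ωq.2 ∈ (↑((Finset.univ ×ˢ reps).filter fun q : (Fin 3 → Bool) × (Fin 3 → K) => ωq.1.2 = κ q) : Set _)}.ncard =
      ∑ᶠ ω ∈ Ω, ((↑((Finset.univ ×ˢ reps).filter fun q : (Fin 3 → Bool) × (Fin 3 → K) => ω.2 = κ q) :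
        Set ((Fin 3 → Bool) × (Fin 3 → K))).ncard) :=
    ncard_setOf_mem_and_mem_eq_finsum_mem hΩfin
      (fun ω : Submodule 𝒪[K] (Fin 3 → K) × ((Fin 3 → Kˣ) ⧸ fixedUnitStabilizer σ M₀) =>
        ((((Finset.univ : Finset (Fin 3 → Bool)) ×ˢ reps).filter fun q : (Fin 3 → Bool) × (Fin 3 → K) => ω.2 = κ q :
          Finset ((Fin 3 → Bool) × (Fin 3 → K))) : Set ((Fin 3 → Bool) × (Fin 3 → K))))
      (fun ω _ => Finset.finite_toSet _)
  have hB2 : ∑ᶠ ω ∈ Ω, ((Finset.univ ×ˢ reps).filter fun q : (Fin 3 → Bool) × (Fin 3 → K) => ω.2 = κ q).card =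
      {ωq : (Submodule 𝒪[K] (Fin 3 → K) × ((Fin 3 → Kˣ) ⧸ fixedUnitStabilizer σ M₀)) × ((Fin 3 → Bool) × (Fin 3 → K)) |
        ωq.1 ∈ Ω ∧ ωq.2 ∈ (↑((Finset.univ ×ˢ reps).filter fun q : (Fin 3 → Bool) × (Fin 3 → K) => ωq.1.2 = κ q) : Set _)}.ncard := by
    rw [hB2']
    exact finsum_mem_congr rfl fun ω _ => by rw [Set.ncard_coe_finset]
  have hB3 : {ωq : (Submodule 𝒪[K] (Fin 3 → K) × ((Fin 3 → Kˣ) ⧸ fixedUnitStabilizer σ M₀)) × ((Fin 3 → Bool) × (Fin 3 → K)) |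
        ωq.1 ∈ Ω ∧ ωq.2 ∈ (↑((Finset.univ ×ˢ reps).filter fun q : (Fin 3 → Bool) × (Fin 3 → K) => ωq.1.2 = κ q) : Set _)}.ncard =
      {qω : ((Fin 3 → Bool) × (Fin 3 → K)) × (Submodule 𝒪[K] (Fin 3 → K) × ((Fin 3 → Kˣ) ⧸ fixedUnitStabilizer σ M₀)) |
        qω.1 ∈ (↑((Finset.univ : Finset (Fin 3 → Bool)) ×ˢ reps) : Set ((Fin 3 → Bool) × (Fin 3 → K))) ∧ qω.2 ∈ {ω ∈ Ω | ω.2 = κ qω.1}}.ncard := by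
    rw [← Set.ncard_image_of_injective _ Prod.swap_injective, Set.image_swap_eq_preimage_swap]
    congr 1
    ext ⟨q, ω⟩
    simp only [Set.mem_preimage, Prod.swap_prod_mk, Set.mem_setOf_eq, Finset.coe_filter, Finset.mem_coe]
    tauto
  have hB4 : {qω : ((Fin 3 → Bool) × (Fin 3 → K)) × (Submodule 𝒪[K] (Fin 3 → K) × ((Fin 3 → Kˣ) ⧸ fixedUnitStabilizer σ M₀)) |
        qω.1 ∈ (↑((Finset.univ : Finset (Fin 3 → Bool)) ×ˢ reps) : Set ((Fin 3 → Bool) × (Fin 3 → K))) ∧ qω.2 ∈ {ω ∈ Ω | ω.2 = κ qω.1}}.ncard =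
      ∑ q ∈ Finset.univ ×ˢ reps, {ω ∈ Ω | ω.2 = κ q}.ncard := by
    rw [ncard_setOf_mem_and_mem_eq_finsum_mem (Finset.finite_toSet _) (fun q => {ω ∈ Ω | ω.2 = κ q})
      (fun q _ => hΩfin.subset (Set.sep_subset _ _)), finsum_mem_coe_finset]
  have hB5 : ∑ q ∈ Finset.univ ×ˢ reps, {ω ∈ Ω | ω.2 = κ q}.ncard = reps.card * (m * (latticeStabilizer M₀).relIndex (unitTorus K 3 ⊓ X)) := by
    rw [Finset.sum_product_right, Finset.sum_const_nat hinner]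
  have hC : (∑ᶠ M ∈ Orb, (Fib M).ncard) * X.relIndex (unitStabilizer M₀) =
      reps.card * (m * (latticeStabilizer M₀).relIndex (unitTorus K 3 ⊓ X)) := by
    rw [← hPsetcard, ← hA4, ← hA3, ← hA2, hA1, hB1, hB2, hB3, hB4, hB5]
  have hI : X.relIndex (unitStabilizer M₀) * (unitStabilizer M₀).relIndex (unitTorus K 3) =
      (latticeStabilizer M₀).relIndex (unitTorus K 3 ⊓ X) * X.relIndex (unitTorus K 3) := relIndex_unitStabilizer_mul_relIndex_eq M₀ X
  have hpos : 0 < X.relIndex (unitStabilizer M₀) * X.relIndex (unitTorus K 3) := Nat.pos_of_ne_zero (mul_ne_zero hXS0 hXT0)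
  refine Nat.eq_of_mul_eq_mul_right hpos ?_
  calc (∑ᶠ M ∈ Orb, (Fib M).ncard) * (fixedUnitStabilizer σ M₀).relIndex (fixedUnitTorus σ 3) *
        (X.relIndex (unitStabilizer M₀) * X.relIndex (unitTorus K 3))
      = ((∑ᶠ M ∈ Orb, (Fib M).ncard) * X.relIndex (unitStabilizer M₀)) * X.relIndex (unitTorus K 3) *
          (fixedUnitStabilizer σ M₀).relIndex (fixedUnitTorus σ 3) := by ring
    _ = reps.card * (m * (latticeStabilizer M₀).relIndex (unitTorus K 3 ⊓ X)) * X.relIndex (unitTorus K 3) *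
          (fixedUnitStabilizer σ M₀).relIndex (fixedUnitTorus σ 3) := by rw [hC]
    _ = reps.card * ((latticeStabilizer M₀).relIndex (unitTorus K 3 ⊓ X) * X.relIndex (unitTorus K 3)) *
          (m * (fixedUnitStabilizer σ M₀).relIndex (fixedUnitTorus σ 3)) := by ring
    _ = reps.card * (X.relIndex (unitStabilizer M₀) * (unitStabilizer M₀).relIndex (unitTorus K 3)) *
          (8 * X.relIndex (unitTorus K 3)) := by rw [← hI, hE]
    _ = 8 * (unitStabilizer M₀).relIndex (unitTorus K 3) * reps.card * (X.relIndex (unitStabilizer M₀) * X.relIndex (unitTorus K 3)) := by ring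

end Summit.HodgeConjecture.HodgeConjecture.Cruxes.H413.F0P3cDyRamDiagonalOrbitFibreCountMultHead

end
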